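import Literature.Probability.LatticeModels.FKObservableL2Bound
import HarnessLib

/-!
# From a bulk sup bound to a Lipschitz bound, for complex functions with harmonic parts

Topic `Literature/Probability/LatticeModels`; the generic form of the Lipschitz step of
`FKObservableL2Bound.lean` (`norm_sub_fkIsingObservable_le_of_bulk`; Smirnov 2010, end of §5:
equicontinuity of `F_δ/√δ` from the interior gradient estimate for discrete harmonic functions),
separated from the FK-Ising observable so that it serves the spin fermion of
Chelkak–Hongler–Izyurov 2015 (Thm 3.12) as well:

* **`norm_sub_le_of_harmonic_of_norm_le`**: if `Re g`, `Im g` are lattice-harmonic on the ball of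
  radius `4m` about the centre of the box of side `4m` at `a` (`m = 8q`, `q ≥ 8`) and `‖g‖ ≤ M₀` on
  the ball of radius `2q`, then `‖g(x + e_j) - g(x)‖ ≤ 8 C_top M₀ / (2q)` on the ball of radius `q`
  (`BoxDirichlet.harmonic_box_gradient_le`).

Everything is proved; no named fact.

## References

* S. Smirnov, Ann. of Math. 172 (2010), §5 [Smirnov2010].
* D. Chelkak, C. Hongler, K. Izyurov, Ann. of Math. 181 (2015), Thm 3.12 [ChelkakHonglerIzyurovAnnals2015].
-/

noncomputable section

namespace Literature.Probability.LatticeModels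

open Finset Real Complex

/-- **Lipschitz bound from a sup bound for a function with harmonic parts.** [cite: Smirnov2010, §5 (precompactness)] -/
theorem norm_sub_le_of_harmonic_of_norm_le {g : Site 2 → ℂ} {a : Site 2} {q : ℕ} (hq : 8 ≤ q)
    (hre : IsLatticeHarmonicOn (fun u => (g u).re)
      (latticeBall (boxCentre a (4 * (2 * q))) (2 * (2 * (4 * (2 * q)))) : Set (Site 2)))
    (him : IsLatticeHarmonicOn (fun u => (g u).im)
      (latticeBall (boxCentre a (4 * (2 * q))) (2 * (2 * (4 * (2 * q)))) : Set (Site 2)))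
    {M₀ : ℝ} (hM0 : 0 ≤ M₀) (hsup : ∀ y ∈ latticeBall (boxCentre a (4 * (2 * q))) (2 * q : ℕ), ‖g y‖ ≤ M₀)
    {x : Site 2} (hx : x ∈ latticeBall (boxCentre a (4 * (2 * q))) q) (j : Fin 4) :
    ‖g (x + cornerUnit j) - g x‖ ≤ 8 * topGradConst * M₀ / (2 * q : ℕ) := by
  set p := 2 * q with hp
  set m := 4 * p with hm
  set c := boxCentre a m with hc
  have hN : 16 ≤ 2 * q := by omega
  have hxM : x ∈ boxMiddle (cornerOf x q) (2 * q) := mem_boxMiddle_cornerOf x q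
  have hxc := (mem_latticeBall_boxCentre (a := a) (m := m) (R := q) (y := x)).1 hx
  have hboxsub : boxInterior (cornerOf x q) (2 * q) ⊆ (latticeBall c (2 * (2 * m)) : Set (Site 2)) := by
    intro y hy
    obtain ⟨k0, k0', k1, k1'⟩ := hy
    simp only [cornerOf, Matrix.cons_val_zero, Matrix.cons_val_one] at k0 k0' k1 k1'
    push_cast at k0' k1'
    show y ∈ latticeBall c (2 * (2 * m))
    rw [hc, mem_latticeBall_boxCentre]
    omega
  have hsidesM : ∀ f : Site 2 → ℝ, (∀ y ∈ latticeBall c p, |f y| ≤ M₀) → ∀ i' : ℕ, 0 < i' → i' < 2 * q →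
      |f ![cornerOf x q 0 + i', cornerOf x q 1 + (2 * q : ℕ)]| ≤ M₀ ∧ |f ![cornerOf x q 0 + i', cornerOf x q 1]| ≤ M₀ ∧
      |f ![cornerOf x q 0, cornerOf x q 1 + i']| ≤ M₀ ∧ |f ![cornerOf x q 0 + (2 * q : ℕ), cornerOf x q 1 + i']| ≤ M₀ := by
    intro f hf i' hi' hi'q
    refine ⟨hf _ ?_, hf _ ?_, hf _ ?_, hf _ ?_⟩
    all_goals
      simp only [hc, mem_latticeBall_boxCentre, cornerOf, Matrix.cons_val_zero, Matrix.cons_val_one]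
      push_cast
      omega
  have hgrad : ∀ f : Site 2 → ℝ, IsLatticeHarmonicOn f (latticeBall c (2 * (2 * m)) : Set (Site 2)) →
      (∀ y ∈ latticeBall c p, |f y| ≤ M₀) → |f (x + cornerUnit j) - f x| ≤ 4 * topGradConst * M₀ / (2 * q : ℕ) := by
    intro f hf hfM
    exact harmonic_box_gradient_le (cornerOf x q) (2 * q) hN (fun y hy => hf y (hboxsub hy)) hM0 (hsidesM f hfM) hxM j
  have hre' := hgrad (fun u => (g u).re) hre fun y hy => (abs_re_le_norm _).trans (hsup y hy)
  have him' := hgrad (fun u => (g u).im) him fun y hy => (abs_im_le_norm _).trans (hsup y hy)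
  calc ‖g (x + cornerUnit j) - g x‖
      ≤ |(g (x + cornerUnit j) - g x).re| + |(g (x + cornerUnit j) - g x).im| := norm_le_abs_re_add_abs_im' _
    _ ≤ 4 * topGradConst * M₀ / (2 * q : ℕ) + 4 * topGradConst * M₀ / (2 * q : ℕ) := by
        rw [sub_re, sub_im]; exact add_le_add hre' him'
    _ = 8 * topGradConst * M₀ / (2 * q : ℕ) := by ring

end Literature.Probability.LatticeModels
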